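import Mathlib
import Summits.Ventures.HodgeRepro.Tier4.Line4.FinitePlacePositivity

/-!
# Tier4/Line4/FinitePlacePositivityCompact — C-L4-FINPOS′: finite-place positivity on ARBITRARY compact torus sets

Blind re-derivation cell `pub-hodge-repro`, Tier 4 «prove the step» (README §9–§10), seat t4-L4-p2 (prover, LINE L4,
gen 3; plan-4 g3's cut S14375, statement VERBATIM from proofs/t4-plan-4/work/FinitePlacePositivityCompact-STATEMENTS.lean
56517a57dd3314b0 — only this header replaced). Tree path
`lean/Summits/Ventures/HodgeRepro/Tier4/Line4/FinitePlacePositivityCompact.lean`. Mathlib-level; no literature. Input: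
t4-L2-p3's `Line4/FinitePlacePositivity` (p691079: `exists_level_re_pos_of_regular` and its toolbox — `finT`, `finT'`,
`continuous_ofFinPart`, `ofFinPart_conj_eq_of_ofFinPart_eq`, `re_pos_of_stabiliser`, `levelDoubleCoset`,
`isCompact_levelDoubleCoset`, `levelDoubleCoset_antitone`, `eq_of_mem_levelDoubleCoset_factorial`).

THE MODIFICATION (plan-4 S14375): L2-p3's nested-compact argument with `D := A ×ˢ A′` for ANY compact `A ⊆ T(𝔸)`,
`A′ ⊆ T′(𝔸)` in place of `closure D_T ×ˢ closure D_{T′}` — nothing else changes (the fibre lemma, the decreasing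
compact sets `A n`, the emptiness argument are on `D`).  The consumer (C-L4-UNFOLD-Z's right-hand side) integrates `t`
over a `Z(k)`-domain (compact closure) and `t′` over a compact set cut out by the support of the test function.  The
second theorem is the original statement as the instance `A = closure D_T`, `A′ = closure D_{T′}` (sanity, the binder
shapes agree).

Nothing here says anything about the status of the Hodge conjecture for CM abelian varieties, which is NOT proved
(HC_CM is NOT proved by anyone in this repository).
-/

set_option autoImplicit false
noncomputable section
namespace Summit.Ventures.HodgeRepro.Tier4.Line4
open Summit.Ventures.HodgeRepro.Tier4 Summit.Ventures.HodgeRepro.Tier4.Common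
  Summit.Ventures.HodgeRepro.Tier4.Line1
open scoped ComplexConjugate Topology Pointwise

variable {k : Type} [Field k] [NumberField k] (W : PlaneData k)
variable [MeasurableSpace (torusT W)] [MeasurableSpace (torusT' W)]

/-- **Finite-place positivity on arbitrary compact torus sets** (cut C-L4-FINPOS′): `exists_level_re_pos_of_regular` with
the two closures of the fundamental domains replaced by ANY compact `A ⊆ T(𝔸)`, `A′ ⊆ T′(𝔸)` — the same nested-compact
argument on `A ×ˢ A′`. The consumer integrates over a `Z(k)`-domain `D_Z` (compact closure) and a compact `t′`-set cut out
by the support of the test function. -/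
theorem exists_level_re_pos_of_regular_compact (R : RTFData W) (hχ : Continuous R.chi) (hχ' : Continuous R.chi')
    (hχ1 : R.chi 1 = 1) (γ₀ : rationalPoints W) (hreg : IsRegularRational W γ₀)
    (A : Set (torusT W)) (hA : IsCompact A) (A' : Set (torusT' W)) (hA' : IsCompact A') :
    ∃ N : ℕ, N ≠ 0 ∧ ∀ t ∈ A, ∀ t' ∈ A',
      GA.ofFinPart W ((t : GA W)⁻¹ * γ₀ * t') ∈
          (levelK W N : Set (GA W)) * {GA.ofFinPart W (γ₀ : GA W)} * (levelK W N : Set (GA W)) →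
        ∀ (ht : GA.ofFinPart W (t : GA W) ∈ torusT W) (ht' : GA.ofFinPart W (t' : GA W) ∈ torusT' W),
          0 < (R.chi ⟨_, ht⟩ * conj (R.chi' ⟨_, ht'⟩)).re := by
  classical
  haveI : T2Space (GA W) := t2Space_GA W
  -- the finite-part orbit map, the compact domain and the open target
  set γf : GA W := GA.ofFinPart W (γ₀ : GA W) with hγf
  set f : torusT W × torusT' W → GA W := fun p => GA.ofFinPart W ((p.1 : GA W)⁻¹ * γ₀ * p.2) with hfdef
  have hf : Continuous f :=
    (continuous_ofFinPart W).comp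
      (((continuous_subtype_val.comp continuous_fst).inv.mul continuous_const).mul
        (continuous_subtype_val.comp continuous_snd))
  set D : Set (torusT W × torusT' W) := A ×ˢ A' with hDdef
  have hD : IsCompact D := hA.prod hA'
  have hDc : IsClosed D := hA.isClosed.prod hA'.isClosed
  set U : Set (torusT W × torusT' W) :=
    {p | 0 < (R.chi (finT W p.1) * conj (R.chi' (finT' W p.2))).re} with hUdef
  have hU : IsOpen U :=
    isOpen_lt continuous_const
      (Complex.continuous_re.comp ((hχ.comp ((continuous_finT W).comp continuous_fst)).mul
        (Complex.continuous_conj.comp (hχ'.comp ((continuous_finT' W).comp continuous_snd)))))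
  -- the fibre over `γf` lies in `U`
  have hfib : ∀ p : torusT W × torusT' W, f p = γf → p ∈ U := by
    rintro ⟨t, t'⟩ hp
    have hp' : (GA.ofFinPart W (t : GA W))⁻¹ * (γ₀ : GA W) * GA.ofFinPart W (t' : GA W) = γ₀ :=
      ofFinPart_conj_eq_of_ofFinPart_eq W (γ₀ : GA W) t t' hp
    obtain ⟨hz, hte⟩ := hreg _ (ofFinPart_mem_torusT W t.2) _ (ofFinPart_mem_torusT' W t'.2) hp'
    exact re_pos_of_stabiliser W R hχ1 (finT W t) (finT' W t') hz hte
  -- the decreasing compact sets `B n = D ∩ f⁻¹(K((n+1)!) γf K((n+1)!)) ∩ Uᶜ`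
  set B : ℕ → Set (torusT W × torusT' W) :=
    fun n => D ∩ f ⁻¹' levelDoubleCoset W (n + 1).factorial γf ∩ Uᶜ with hBdef
  have hBcl : ∀ n, IsClosed (B n) := fun n =>
    (hDc.inter ((isCompact_levelDoubleCoset W (Nat.factorial_ne_zero _) γf).isClosed.preimage hf)).inter
      hU.isClosed_compl
  have hBanti : ∀ n, B (n + 1) ⊆ B n := by
    intro n p hp
    refine ⟨⟨hp.1.1, ?_⟩, hp.2⟩
    exact levelDoubleCoset_antitone W (Nat.factorial_dvd_factorial (Nat.le_succ (n + 1))) _ hp.1.2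
  have hB0 : IsCompact (B 0) := hD.of_isClosed_subset (hBcl 0) (fun p hp => hp.1.1)
  -- some `B n` is empty
  have hempty : ∃ n, ¬ (B n).Nonempty := by
    by_contra hall
    have hall' : ∀ n, (B n).Nonempty := fun n => by_contra fun h => hall ⟨n, h⟩
    obtain ⟨p, hp⟩ := IsCompact.nonempty_iInter_of_sequence_nonempty_isCompact_isClosed B hBanti hall' hB0 hBcl
    have hmem : ∀ n, f p ∈ levelDoubleCoset W (n + 1).factorial γf := fun n => (Set.mem_iInter.1 hp n).1.2
    have hfp : f p = γf := eq_of_mem_levelDoubleCoset_factorial W γf (f p) hmem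
    exact (Set.mem_iInter.1 hp 0).2 (hfib p hfp)
  obtain ⟨n, hn⟩ := hempty
  refine ⟨(n + 1).factorial, Nat.factorial_ne_zero _, fun t ht t' ht' hmem htm htm' => ?_⟩
  by_contra hneg
  apply hn
  have hmem' : (t, t') ∈ f ⁻¹' levelDoubleCoset W (n + 1).factorial γf := hmem
  have hneg' : (t, t') ∈ Uᶜ := hneg
  exact ⟨(t, t'), ⟨⟨Set.mk_mem_prod ht ht', hmem'⟩, hneg'⟩⟩

/-- The original is the case `A = closure D_T`, `A′ = closure D_{T′}` (sanity; not a new fact). -/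
theorem exists_level_re_pos_of_regular_of_compact (R : RTFData W) (hχ : Continuous R.chi) (hχ' : Continuous R.chi')
    (hχ1 : R.chi 1 = 1) (γ₀ : rationalPoints W) (hreg : IsRegularRational W γ₀)
    (hT : IsCompact (closure R.DT)) (hT' : IsCompact (closure R.DT')) :
    ∃ N : ℕ, N ≠ 0 ∧ ∀ t ∈ closure R.DT, ∀ t' ∈ closure R.DT',
      GA.ofFinPart W ((t : GA W)⁻¹ * γ₀ * t') ∈
          (levelK W N : Set (GA W)) * {GA.ofFinPart W (γ₀ : GA W)} * (levelK W N : Set (GA W)) →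
        ∀ (ht : GA.ofFinPart W (t : GA W) ∈ torusT W) (ht' : GA.ofFinPart W (t' : GA W) ∈ torusT' W),
          0 < (R.chi ⟨_, ht⟩ * conj (R.chi' ⟨_, ht'⟩)).re :=
  exists_level_re_pos_of_regular_compact W R hχ hχ' hχ1 γ₀ hreg _ hT _ hT'

end Summit.Ventures.HodgeRepro.Tier4.Line4
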